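import Mathlib
import Literature.Analysis.FluidPDE.VectorCalculus
import Literature.Analysis.FluidPDE.TaoAveragedNondegeneracy
import Summits.NavierStokesRegularity.NavierStokesRegularity.Theorems.FilamentSkeletonRssSkeletonEquilibriumGyrationFreeArcs

/-!
# Limit tools for the compactness step of `stub_mirrorPointSelection`
(helper for the registered stub `stub_mirrorPointSelection` of crux `FilamentSkeletonRss.SkeletonEquilibrium`,
stmt-NavierStokesRegularity-15400; notation of `…GyrationFreeRigidity` / `…GyrationFreeArcs`)

The reduction "stub ⟸ rigidity (`…GyrationFreeRigidity`, `…GyrationFreeArcs`) + continuous dependence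
(`…GyrationContinuity`) + compactness" passes the shell smallness of the stub's DEFECT to the limit of a
convergent sequence of solutions through the POLYNOMIAL locus map `F` (continuous everywhere, unlike the defect,
which divides by `‖B‖`). This file supplies the two facts used there:
* `smul_defect_eq_locus` — at a point with `B = A y ≠ 0`, `(g ‖B‖⁴) • defect = F` exactly (so
  `‖F‖ = |g| ‖B‖⁴ ‖defect‖`, and shell smallness of the defect is smallness of `F`);
* `continuous_locus` — `(y, T) ↦ F(A y, T)` is continuous on `E × E`.
With `MirrorPoint.arc_on_axis_of_locus` (limit solution on the locus on an open interval ⇒ vertical there) and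
`Sketch.stub_forcedShooting` (existence/uniqueness for the limit datum) these are all the inputs of the sequential
compactness argument; its assembly (subsequence of recentred bad solutions, limit, contradiction) is the remaining
formal step. No summit statement is proved; NS regularity is not touched.
-/

noncomputable section

open Set Filter Topology
open Literature.Analysis.FluidPDE Literature.Analysis.FluidPDE.Tao2016
open scoped RealInnerProductSpace InnerProductSpace

namespace Summit.NavierStokesRegularity.NavierStokesRegularity.Theorems.SkeletonEquilibrium.MirrorPoint
set_option linter.dupNamespace false

/-- Defect versus locus: at a point with `B ≠ 0` (`B = A y`), `(g ‖B‖⁴) • defect = F`, where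
`defect = T − c b − (c/g/‖B‖²) b × A T` (`b = ‖B‖⁻¹ B`, `c = ⟪T, b⟫`) and
`F = (g ⟪B,B⟫) • (⟪B,B⟫ T − ⟪T,B⟫ B) − ⟪T,B⟫ • B × A T`. [folklore] -/
theorem smul_defect_eq_locus {g α : ℝ} (hg : g ≠ 0) {B T : EuclideanSpace ℝ (Fin 3)} (hB : B ≠ 0) :
    (g * ‖B‖ ^ 4) • (T - ⟪T, ‖B‖⁻¹ • B⟫ • (‖B‖⁻¹ • B) -
      (⟪T, ‖B‖⁻¹ • B⟫ / g / ‖B‖ ^ 2) •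
        cross (‖B‖⁻¹ • B) ((1 / 2 : ℝ) • T - α • cross (EuclideanSpace.single (2 : Fin 3) (1 : ℝ)) T)) =
    (g * ⟪B, B⟫) • (⟪B, B⟫ • T - ⟪T, B⟫ • B) -
      ⟪T, B⟫ • cross B ((1 / 2 : ℝ) • T - α • cross (EuclideanSpace.single (2 : Fin 3) (1 : ℝ)) T) := by
  have hr : ‖B‖ ≠ 0 := norm_ne_zero_iff.2 hB
  rw [real_inner_smul_right, cross_smul_left, smul_smul, smul_smul]
  have hn : ⟪B, B⟫ = ‖B‖ ^ 2 := real_inner_self_eq_norm_sq B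
  have s1 : g * ‖B‖ ^ 4 * (‖B‖⁻¹ * ⟪T, B⟫ * ‖B‖⁻¹) = g * ‖B‖ ^ 2 * ⟪T, B⟫ := by
    field_simp
  have s2 : g * ‖B‖ ^ 4 * (‖B‖⁻¹ * ⟪T, B⟫ / g / ‖B‖ ^ 2 * ‖B‖⁻¹) = ⟪T, B⟫ := by
    field_simp
  simp only [smul_sub, smul_smul, s1, s2]
  rw [hn, show g * ‖B‖ ^ 2 * ‖B‖ ^ 2 = g * ‖B‖ ^ 4 by ring]

/-- Continuity of the locus map `(y, T) ↦ F(A y, T)` (polynomial in the coordinates). [folklore] -/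
theorem continuous_locus (g α : ℝ) :
    Continuous (fun p : EuclideanSpace ℝ (Fin 3) × EuclideanSpace ℝ (Fin 3) =>
      (g * ⟪(1 / 2 : ℝ) • p.1 - α • cross (EuclideanSpace.single (2 : Fin 3) (1 : ℝ)) p.1,
          (1 / 2 : ℝ) • p.1 - α • cross (EuclideanSpace.single (2 : Fin 3) (1 : ℝ)) p.1⟫) •
        (⟪(1 / 2 : ℝ) • p.1 - α • cross (EuclideanSpace.single (2 : Fin 3) (1 : ℝ)) p.1,
            (1 / 2 : ℝ) • p.1 - α • cross (EuclideanSpace.single (2 : Fin 3) (1 : ℝ)) p.1⟫ • p.2 -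
          ⟪p.2, (1 / 2 : ℝ) • p.1 - α • cross (EuclideanSpace.single (2 : Fin 3) (1 : ℝ)) p.1⟫ •
            ((1 / 2 : ℝ) • p.1 - α • cross (EuclideanSpace.single (2 : Fin 3) (1 : ℝ)) p.1)) -
      ⟪p.2, (1 / 2 : ℝ) • p.1 - α • cross (EuclideanSpace.single (2 : Fin 3) (1 : ℝ)) p.1⟫ •
        cross ((1 / 2 : ℝ) • p.1 - α • cross (EuclideanSpace.single (2 : Fin 3) (1 : ℝ)) p.1)
          ((1 / 2 : ℝ) • p.2 - α • cross (EuclideanSpace.single (2 : Fin 3) (1 : ℝ)) p.2)) := by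
  have hcr3 : Continuous (fun y : EuclideanSpace ℝ (Fin 3) =>
      cross (EuclideanSpace.single (2 : Fin 3) (1 : ℝ)) y) :=
    continuous_cross.comp (continuous_const.prodMk continuous_id)
  have hA : Continuous (fun y : EuclideanSpace ℝ (Fin 3) =>
      (1 / 2 : ℝ) • y - α • cross (EuclideanSpace.single (2 : Fin 3) (1 : ℝ)) y) :=
    (continuous_id.const_smul (1 / 2 : ℝ)).sub (hcr3.const_smul α)
  have h1 : Continuous (fun p : EuclideanSpace ℝ (Fin 3) × EuclideanSpace ℝ (Fin 3) =>
      (1 / 2 : ℝ) • p.1 - α • cross (EuclideanSpace.single (2 : Fin 3) (1 : ℝ)) p.1) := hA.comp continuous_fst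
  have h2 : Continuous (fun p : EuclideanSpace ℝ (Fin 3) × EuclideanSpace ℝ (Fin 3) =>
      (1 / 2 : ℝ) • p.2 - α • cross (EuclideanSpace.single (2 : Fin 3) (1 : ℝ)) p.2) := hA.comp continuous_snd
  have hn : Continuous (fun p : EuclideanSpace ℝ (Fin 3) × EuclideanSpace ℝ (Fin 3) =>
      ⟪(1 / 2 : ℝ) • p.1 - α • cross (EuclideanSpace.single (2 : Fin 3) (1 : ℝ)) p.1,
        (1 / 2 : ℝ) • p.1 - α • cross (EuclideanSpace.single (2 : Fin 3) (1 : ℝ)) p.1⟫) := h1.inner h1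
  have hc : Continuous (fun p : EuclideanSpace ℝ (Fin 3) × EuclideanSpace ℝ (Fin 3) =>
      ⟪p.2, (1 / 2 : ℝ) • p.1 - α • cross (EuclideanSpace.single (2 : Fin 3) (1 : ℝ)) p.1⟫) :=
    continuous_snd.inner h1
  have hcr : Continuous (fun p : EuclideanSpace ℝ (Fin 3) × EuclideanSpace ℝ (Fin 3) =>
      cross ((1 / 2 : ℝ) • p.1 - α • cross (EuclideanSpace.single (2 : Fin 3) (1 : ℝ)) p.1)
        ((1 / 2 : ℝ) • p.2 - α • cross (EuclideanSpace.single (2 : Fin 3) (1 : ℝ)) p.2)) :=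
    continuous_cross.comp (h1.prodMk h2)
  exact ((continuous_const.mul hn).smul ((hn.smul continuous_snd).sub (hc.smul h1))).sub (hc.smul hcr)

end Summit.NavierStokesRegularity.NavierStokesRegularity.Theorems.SkeletonEquilibrium.MirrorPoint
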